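import Literature.NumberTheory.Transcendental.ClosingDichotomy
import HarnessLib

/-!
# Baker's method on `M_κ`: the parameter family (integer-exponent form)

Topic: `Literature/NumberTheory/Transcendental`. Plan item W4 (parameter choice, part 1) of
the unit `provefact-Literature.NumberTheory.Transcendental.H-b596640137`. Towards the
satisfiability of `ClosingDichotomy.AdmissibleParams` we fix a ONE-parameter family of
parameters with integer exponents (no roots, no floors), indexed by `σ ∈ ℕ` large:

* `S₀ = σ^n - 1` (so `S₀ + 1 = σ^n`), `T = 4n·σ^{an}`, `T″ = 2σ^{an} - 1` (so that
  `nT″ + 1 ≤ T/2`), `D' = 2·(4n)^{dd}·σ^{1 + a·dd}` (Siegel feasibility with `q ≥ 2p`),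
  `S = ℓ·σ^n`, `R = σ^b · 2(nS + S₀)`;

and PROVE the elementary clauses of `AdmissibleParams` for it: positivity, `D' ≥ 1`, `S ≥ 1`,
Siegel feasibility `(S₀+1)T^{dd} < (D'+1)^n`, `R > 0`, `R ≥ 2(nS+S₀)`
(`BakerData.Family.basic_clauses`), the order bookkeeping `n T″ + 1 ≤ T/2`, and the
monotonicity of `e ↦ binom(N+e, e)` (`choose_add_mono`; the same statement exists cross-topic as
`choose_le_choose_add_add` in `Literature/Computability/Complexity/CliqueApproximatorsWide.lean`)
together with Mathlib's lower bound `Nat.pow_le_choose` (`(N+1)^e/e! ≤ binom(N+e,e)`) used by the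
zero-estimate numerics. The numerical condition `NumCond₂` and the zero-estimate
numerics are treated in the sequels.

## References

* A. Baker, G. Wüstholz, *Logarithmic Forms and Diophantine Geometry*, CUP 2007, §6.8 (p. 119:
  `D = S^{4d}ℓ'S'`, `T = S^{4n}(ℓ'S')^{(n-1)/d}`).
-/

noncomputable section

open Finset
open scoped PeriodPair

namespace Literature.NumberTheory.Transcendental

/-! ### Binomial coefficients `binom(N + e, e)` -/

/-- `e ↦ binom(N+e, e)` is monotone. [folklore] -/
theorem choose_add_mono (N : ℕ) {e e' : ℕ} (h : e ≤ e') : Nat.choose (N + e) e ≤ Nat.choose (N + e') e' := by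
  induction h with
  | refl => exact le_rfl
  | step _ ih =>
    rename_i e'
    refine ih.trans ?_
    rw [Nat.add_succ, Nat.choose_succ_succ]
    exact Nat.le_add_right _ _

namespace GaGmE

namespace Std

namespace BakerData

/-! ### The family -/

/-- The parameter family of Baker's method on `M_κ`, indexed by `σ`: exponents `a, b`, ratio `ℓ`.
[cite: BakerWustholz2007, §6.8 (p. 119)] -/
structure Family where
  /-- exponent of `T = 4n σ^{an}` -/
  a : ℕ
  /-- exponent of the radius ratio `ρ = σ^b` -/
  b : ℕ
  /-- ratio `S/(S₀+1) = ℓ` -/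
  ℓ : ℕ
  /-- `ℓ ≥ 1` -/
  hℓ : 1 ≤ ℓ

namespace Family

variable (F : Family) (n dd : ℕ)

/-- `S₀ = σ^n - 1`. [folklore] -/
def S₀ (σ : ℕ) : ℕ := σ ^ n - 1
/-- `T = 4n σ^{an}`. [folklore] -/
def T (σ : ℕ) : ℕ := 4 * n * σ ^ (F.a * n)
/-- `T″ = 2σ^{an} - 1`. [folklore] -/
def T₂ (σ : ℕ) : ℕ := 2 * σ ^ (F.a * n) - 1
/-- `D' = 2 (4n)^{dd} σ^{1 + a dd}`. [folklore] -/
def D' (σ : ℕ) : ℕ := 2 * (4 * n) ^ dd * σ ^ (1 + F.a * dd)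
/-- `S = ℓ σ^n`. [folklore] -/
def S (σ : ℕ) : ℕ := F.ℓ * σ ^ n
/-- `R = σ^b · 2(nS + S₀)`. [folklore] -/
def R (σ : ℕ) : ℝ := (σ : ℝ) ^ F.b * (2 * (((n * F.S n σ : ℕ) : ℝ) + S₀ n σ))

/-! ### The elementary clauses -/

/-- `S₀ + 1 = σ^n` for `σ ≥ 1`. [folklore] -/
theorem S₀_add_one {σ : ℕ} (hσ : 1 ≤ σ) : S₀ n σ + 1 = σ ^ n := by
  unfold S₀; have := Nat.one_le_pow n σ hσ; omega

/-- `T > 0` for `n, σ ≥ 1`. [folklore] -/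
theorem T_pos (hn : 1 ≤ n) {σ : ℕ} (hσ : 1 ≤ σ) : 0 < F.T n σ := by
  unfold T; have := Nat.one_le_pow (F.a * n) σ hσ; positivity

/-- `n T″ + 1 ≤ T / 2` for `n, σ ≥ 1`. [folklore] -/
theorem orders_le (hn : 1 ≤ n) {σ : ℕ} (hσ : 1 ≤ σ) : n * F.T₂ n σ + 1 ≤ F.T n σ / 2 := by
  unfold T T₂
  have h1 := Nat.one_le_pow (F.a * n) σ hσ
  have e : 4 * n * σ ^ (F.a * n) / 2 = 2 * n * σ ^ (F.a * n) := by
    rw [show 4 * n * σ ^ (F.a * n) = 2 * (2 * n * σ ^ (F.a * n)) by ring, Nat.mul_div_cancel_left _ two_pos]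
  rw [e, Nat.mul_sub, mul_one]
  have : n ≤ n * (2 * σ ^ (F.a * n)) := Nat.le_mul_of_pos_right n (by omega)
  calc n * (2 * σ ^ (F.a * n)) - n + 1 ≤ n * (2 * σ ^ (F.a * n)) := by omega
    _ = 2 * n * σ ^ (F.a * n) := by ring

/-- `T″ ≥ σ^{an}` for `σ ≥ 1`. [folklore] -/
theorem pow_le_T₂ {σ : ℕ} (hσ : 1 ≤ σ) : σ ^ (F.a * n) ≤ F.T₂ n σ := by
  unfold T₂; have := Nat.one_le_pow (F.a * n) σ hσ; omega

/-- `D' ≥ 1` for `n, σ ≥ 1`. [folklore] -/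
theorem one_le_D' (hn : 1 ≤ n) {σ : ℕ} (hσ : 1 ≤ σ) : 1 ≤ F.D' n dd σ := by
  unfold D'
  have := Nat.one_le_pow (1 + F.a * dd) σ hσ
  have : 1 ≤ (4 * n) ^ dd := Nat.one_le_pow _ _ (by omega)
  calc 1 ≤ 2 * 1 * 1 := by norm_num
    _ ≤ 2 * (4 * n) ^ dd * σ ^ (1 + F.a * dd) := by gcongr

/-- `S ≥ 1` for `σ ≥ 1`. [folklore] -/
theorem one_le_S {σ : ℕ} (hσ : 1 ≤ σ) : 1 ≤ F.S n σ := by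
  unfold S; exact Nat.one_le_iff_ne_zero.mpr (Nat.mul_ne_zero (by have := F.hℓ; omega) (by positivity))

/-- **Siegel feasibility**: `(S₀+1) T^{dd} < (D'+1)^n` (with `q ≥ 2p`). [folklore] -/
theorem siegel_feasible (hn : 1 ≤ n) {σ : ℕ} (hσ : 1 ≤ σ) :
    (S₀ n σ + 1) * F.T n σ ^ dd < (F.D' n dd σ + 1) ^ n := by
  rw [S₀_add_one n hσ]
  unfold T D'
  -- `(S₀+1) T^{dd} = (4n)^{dd} σ^{n + a n dd} ≤ (D')^n /2 < (D'+1)^n`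
  have key : σ ^ n * (4 * n * σ ^ (F.a * n)) ^ dd ≤ (2 * (4 * n) ^ dd * σ ^ (1 + F.a * dd)) ^ n := by
    have hσeq : σ ^ n * (σ ^ (F.a * n)) ^ dd = (σ ^ (1 + F.a * dd)) ^ n := by
      rw [← pow_mul, ← pow_mul, ← pow_add]
      congr 1; ring
    have h2 : (4 * n) ^ dd ≤ 2 ^ n * ((4 * n) ^ dd) ^ n := by
      have hb : 1 ≤ (4 * n) ^ dd := Nat.one_le_pow _ _ (by omega)
      calc (4 * n) ^ dd = ((4 * n) ^ dd) ^ 1 := (pow_one _).symm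
        _ ≤ ((4 * n) ^ dd) ^ n := Nat.pow_le_pow_right hb hn
        _ ≤ 2 ^ n * ((4 * n) ^ dd) ^ n := Nat.le_mul_of_pos_left _ (by positivity)
    calc σ ^ n * (4 * n * σ ^ (F.a * n)) ^ dd = (4 * n) ^ dd * (σ ^ n * (σ ^ (F.a * n)) ^ dd) := by
          rw [mul_pow (4 * n) (σ ^ (F.a * n)) dd]; ring
      _ = (4 * n) ^ dd * (σ ^ (1 + F.a * dd)) ^ n := by rw [hσeq]
      _ ≤ (2 ^ n * ((4 * n) ^ dd) ^ n) * (σ ^ (1 + F.a * dd)) ^ n := Nat.mul_le_mul_right _ h2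
      _ = (2 * (4 * n) ^ dd * σ ^ (1 + F.a * dd)) ^ n := by
          rw [mul_pow (2 * (4 * n) ^ dd) (σ ^ (1 + F.a * dd)) n, mul_pow 2 ((4 * n) ^ dd) n]
  calc σ ^ n * (4 * n * σ ^ (F.a * n)) ^ dd ≤ (2 * (4 * n) ^ dd * σ ^ (1 + F.a * dd)) ^ n := key
    _ < (2 * (4 * n) ^ dd * σ ^ (1 + F.a * dd) + 1) ^ n :=
        Nat.pow_lt_pow_left (Nat.lt_succ_self _) (by omega)

/-- `2(nS + S₀) ≤ R` and `0 < R` for `n, σ ≥ 1`. [folklore] -/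
theorem R_bounds (hn : 1 ≤ n) {σ : ℕ} (hσ : 1 ≤ σ) :
    0 < F.R n σ ∧ 2 * ((((n * F.S n σ : ℕ)) : ℝ) + S₀ n σ) ≤ F.R n σ := by
  unfold R
  have hσ' : (1 : ℝ) ≤ (σ : ℝ) ^ F.b := one_le_pow₀ (by exact_mod_cast hσ)
  have h1 : 1 ≤ n * F.S n σ :=
    Nat.one_le_iff_ne_zero.mpr (Nat.mul_ne_zero (by omega) (by have := F.one_le_S n hσ; omega))
  have h1' : (1 : ℝ) ≤ ((n * F.S n σ : ℕ) : ℝ) := by exact_mod_cast h1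
  have h0 : (0 : ℝ) ≤ (S₀ n σ : ℝ) := Nat.cast_nonneg _
  have hpos : (0 : ℝ) < 2 * (((n * F.S n σ : ℕ) : ℝ) + S₀ n σ) := by linarith
  constructor
  · positivity
  · calc 2 * (((n * F.S n σ : ℕ) : ℝ) + S₀ n σ) = 1 * (2 * (((n * F.S n σ : ℕ) : ℝ) + S₀ n σ)) := by ring
      _ ≤ (σ : ℝ) ^ F.b * (2 * (((n * F.S n σ : ℕ) : ℝ) + S₀ n σ)) := mul_le_mul_of_nonneg_right hσ' hpos.le

/-! ### The zero-estimate numerics for the family -/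

/-- The exponent bookkeeping of the non-strict numerics: from `dd(n-m) ≤ en`,
`(1 + a·dd)(n - m) ≤ n - m + a·n·e`. [folklore] -/
theorem exp_le_A {n dd a e m : ℕ} (_hm : m ≤ n) (hidx : dd * (n - m) ≤ e * n) :
    (1 + a * dd) * (n - m) ≤ (n - m) + a * n * e := by
  have : a * (dd * (n - m)) ≤ a * (e * n) := Nat.mul_le_mul_left a hidx
  nlinarith [this]

/-- The exponent bookkeeping of the strict numerics: from `dd(n-m) < en` and `n < a`,
`(1 + a·dd)(n - m) + 1 ≤ a·n·e`. [folklore] -/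
theorem exp_le_B {n dd a e m : ℕ} (_hm : m < n) (ha : n < a) (hidx : dd * (n - m) < e * n) :
    (1 + a * dd) * (n - m) + 1 ≤ a * n * e := by
  have h1 : dd * (n - m) + 1 ≤ e * n := hidx
  have : a * (dd * (n - m) + 1) ≤ a * (e * n) := Nat.mul_le_mul_left a h1
  have hnm : n - m ≤ n := Nat.sub_le _ _
  nlinarith [this, hnm]

/-- `K · σ^E < σ^{E'}` once `E + 1 ≤ E'` and `σ > K ≥ 1`… in the real form used below. [folklore] -/
theorem const_mul_pow_lt_pow {K : ℝ} {σ : ℕ} {E E' : ℕ} (hK : 0 ≤ K) (hE : E + 1 ≤ E') (hσK : K < σ)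
    (hσ : 1 ≤ σ) : K * (σ : ℝ) ^ E < (σ : ℝ) ^ E' := by
  have hσ1 : (1 : ℝ) ≤ σ := by exact_mod_cast hσ
  calc K * (σ : ℝ) ^ E < (σ : ℝ) * (σ : ℝ) ^ E := by
        refine mul_lt_mul_of_pos_right hσK (pow_pos (by linarith) _)
    _ = (σ : ℝ) ^ (E + 1) := by ring
    _ ≤ (σ : ℝ) ^ E' := pow_le_pow_right₀ hσ1 hE

/-- **The zero-estimate numerics for the family, orders `e ≤ n`.** [folklore] -/
theorem numerics_le (hn : 1 ≤ n) (hdd : dd < n) {c : ℝ} (hc : 0 < c) (ha : n < F.a)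
    (hℓc : c * ((n * (2 * (4 * n) ^ dd) : ℕ) : ℝ) ^ n * dd.factorial < F.ℓ) {σ : ℕ} (hσ : 1 ≤ σ)
    (hσK : c * ((n * (2 * (4 * n) ^ dd) : ℕ) : ℝ) ^ n * n.factorial < σ) {e m : ℕ} (hen : e ≤ n)
    (hm : m < n) (hidx : dd * (n - m) ≤ e * n) :
    (c * ((n * F.D' n dd σ : ℕ) : ℝ) ^ n <
        (Nat.choose (F.T₂ n σ + e) e : ℝ) * ((F.S n σ : ℝ) + 1) * ((n * F.D' n dd σ : ℕ) : ℝ) ^ m) ∧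
    (dd * (n - m) < e * n →
      c * ((n * F.D' n dd σ : ℕ) : ℝ) ^ n < (Nat.choose (F.T₂ n σ + e) e : ℝ) * ((n * F.D' n dd σ : ℕ) : ℝ) ^ m) := by
  set κ : ℝ := ((n * (2 * (4 * n) ^ dd) : ℕ) : ℝ) with hκ
  have hκ1 : 1 ≤ κ := by
    rw [hκ]; exact_mod_cast Nat.one_le_iff_ne_zero.mpr (Nat.mul_ne_zero (by omega)
      (Nat.mul_ne_zero two_ne_zero (pow_ne_zero _ (by omega))))
  have hσ1 : (1 : ℝ) ≤ σ := by exact_mod_cast hσ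
  have hmn : m ≤ n := hm.le
  have hD : ((n * F.D' n dd σ : ℕ) : ℝ) = κ * (σ : ℝ) ^ (1 + F.a * dd) := by
    rw [hκ]; unfold D'; push_cast; ring
  have hσ0 : (0 : ℝ) < σ := by linarith
  have hκ0 : (0 : ℝ) < κ := by linarith
  have hDpos : (0 : ℝ) < ((n * F.D' n dd σ : ℕ) : ℝ) := by rw [hD]; exact mul_pos hκ0 (pow_pos hσ0 _)
  have hchoose : (σ : ℝ) ^ (F.a * n * e) / e.factorial ≤ (Nat.choose (F.T₂ n σ + e) e : ℝ) := by
    -- Mathlib's `Nat.pow_le_choose`: `(N+1)^e/e! ≤ binom(N+e, e)`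
    have hM := Nat.pow_le_choose (α := ℝ) e (F.T₂ n σ + e)
    rw [show F.T₂ n σ + e + 1 - e = F.T₂ n σ + 1 by omega] at hM
    refine le_trans (div_le_div_of_nonneg_right ?_ (by positivity)) hM
    push_cast
    rw [pow_mul]
    refine pow_le_pow_left₀ (by positivity) ?_ e
    have : ((σ ^ (F.a * n) : ℕ) : ℝ) ≤ (F.T₂ n σ : ℝ) := by exact_mod_cast F.pow_le_T₂ n hσ
    push_cast at this
    linarith
  have hS : (F.ℓ : ℝ) * (σ : ℝ) ^ n ≤ (F.S n σ : ℝ) + 1 := by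
    unfold S; push_cast; linarith
  have hℓ1 : (1 : ℝ) ≤ F.ℓ := by exact_mod_cast F.hℓ
  have hsplit : ((n * F.D' n dd σ : ℕ) : ℝ) ^ n =
      ((n * F.D' n dd σ : ℕ) : ℝ) ^ (n - m) * ((n * F.D' n dd σ : ℕ) : ℝ) ^ m := by
    rw [← pow_add, Nat.sub_add_cancel hmn]
  have hefact : ((e.factorial : ℕ) : ℝ) ≤ n.factorial := by exact_mod_cast Nat.factorial_le hen
  have hefpos : (0 : ℝ) < e.factorial := by exact_mod_cast e.factorial_pos
  -- the constant `c κ^{n-m} e!` is at most `K = c κ^n n!`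
  have hKle : c * κ ^ (n - m) * (e.factorial : ℝ) ≤ c * κ ^ n * n.factorial := by
    have : κ ^ (n - m) ≤ κ ^ n := pow_le_pow_right₀ hκ1 (Nat.sub_le _ _)
    exact mul_le_mul (mul_le_mul_of_nonneg_left this hc.le) hefact hefpos.le (by positivity)
  have hK0 : 0 ≤ c * κ ^ n * (n.factorial : ℝ) := by positivity
  -- both clauses reduce to `c κ^{n-m} e! σ^{(1+add)(n-m)} < X`; we first isolate this shape
  have reshape : ∀ {X : ℝ}, 0 < X →
      c * κ ^ (n - m) * (e.factorial : ℝ) * (σ : ℝ) ^ ((1 + F.a * dd) * (n - m)) < X * (σ : ℝ) ^ (F.a * n * e) →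
      c * ((n * F.D' n dd σ : ℕ) : ℝ) ^ n <
        ((σ : ℝ) ^ (F.a * n * e) / e.factorial) * X * ((n * F.D' n dd σ : ℕ) : ℝ) ^ m := by
    intro X hX h
    rw [hsplit, hD, mul_pow, ← pow_mul]
    have h' : c * (κ ^ (n - m) * (σ : ℝ) ^ ((1 + F.a * dd) * (n - m))) <
        (σ : ℝ) ^ (F.a * n * e) / e.factorial * X := by
      rw [div_mul_eq_mul_div, lt_div_iff₀ hefpos]
      calc c * (κ ^ (n - m) * (σ : ℝ) ^ ((1 + F.a * dd) * (n - m))) * e.factorial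
          = c * κ ^ (n - m) * (e.factorial : ℝ) * (σ : ℝ) ^ ((1 + F.a * dd) * (n - m)) := by ring
        _ < X * (σ : ℝ) ^ (F.a * n * e) := h
        _ = (σ : ℝ) ^ (F.a * n * e) * X := by ring
    calc c * ((κ ^ (n - m) * (σ : ℝ) ^ ((1 + F.a * dd) * (n - m))) * (κ * (σ : ℝ) ^ (1 + F.a * dd)) ^ m)
        = (c * (κ ^ (n - m) * (σ : ℝ) ^ ((1 + F.a * dd) * (n - m)))) * (κ * (σ : ℝ) ^ (1 + F.a * dd)) ^ m := by ring
      _ < ((σ : ℝ) ^ (F.a * n * e) / e.factorial * X) * (κ * (σ : ℝ) ^ (1 + F.a * dd)) ^ m :=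
          mul_lt_mul_of_pos_right h' (pow_pos (mul_pos hκ0 (pow_pos hσ0 _)) _)
      _ = _ := by ring
  constructor
  · -- non-strict clause, `X = ℓ σ^n`
    have hexp := exp_le_A (a := F.a) hmn hidx
    have hmain' : c * κ ^ (n - m) * (e.factorial : ℝ) * (σ : ℝ) ^ ((1 + F.a * dd) * (n - m)) <
        (F.ℓ : ℝ) * (σ : ℝ) ^ (n + F.a * n * e) := by
      by_cases hgap : (1 + F.a * dd) * (n - m) + 1 ≤ n + F.a * n * e
      · calc c * κ ^ (n - m) * (e.factorial : ℝ) * (σ : ℝ) ^ ((1 + F.a * dd) * (n - m))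
            ≤ (c * κ ^ n * n.factorial) * (σ : ℝ) ^ ((1 + F.a * dd) * (n - m)) :=
              mul_le_mul_of_nonneg_right hKle (by positivity)
          _ < (σ : ℝ) ^ (n + F.a * n * e) := const_mul_pow_lt_pow hK0 hgap hσK hσ
          _ ≤ (F.ℓ : ℝ) * (σ : ℝ) ^ (n + F.a * n * e) := le_mul_of_one_le_left (by positivity) hℓ1
      · -- the borderline exponent: `m = 0`, `e = dd`
        have heq : (1 + F.a * dd) * (n - m) = n + F.a * n * e := by omega
        have hm0 : m = 0 := by
          by_contra h
          have : n - m < n := Nat.sub_lt (by omega) (Nat.pos_of_ne_zero h)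
          nlinarith [hexp, this]
        subst hm0
        simp only [Nat.sub_zero] at heq ⊢
        have hedd : e = dd := by
          have h1 : F.a * dd * n = F.a * n * e := by nlinarith [heq]
          have h2 : F.a * n * dd = F.a * n * e := by rw [← h1]; ring
          exact (Nat.eq_of_mul_eq_mul_left (Nat.mul_pos (by omega) (by omega)) h2).symm
        subst hedd
        rw [heq]
        have hpow : (0 : ℝ) < (σ : ℝ) ^ (n + F.a * n * e) := pow_pos hσ0 _
        have : c * κ ^ n * (e.factorial : ℝ) < F.ℓ := hℓc
        nlinarith
    have hmain : c * κ ^ (n - m) * (e.factorial : ℝ) * (σ : ℝ) ^ ((1 + F.a * dd) * (n - m)) <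
        ((F.ℓ : ℝ) * (σ : ℝ) ^ n) * (σ : ℝ) ^ (F.a * n * e) := by
      have e1 : ((F.ℓ : ℝ) * (σ : ℝ) ^ n) * (σ : ℝ) ^ (F.a * n * e) = (F.ℓ : ℝ) * (σ : ℝ) ^ (n + F.a * n * e) := by
        rw [pow_add]; ring
      rw [e1]; exact hmain'
    exact (reshape (mul_pos (by exact_mod_cast Nat.lt_of_lt_of_le Nat.zero_lt_one F.hℓ) (pow_pos hσ0 _)) hmain).trans_le (by
      refine mul_le_mul_of_nonneg_right (mul_le_mul hchoose hS (by positivity) (Nat.cast_nonneg _))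
        (pow_nonneg hDpos.le _))
  · -- strict clause, `X = 1`
    intro hstrict
    have hexp := exp_le_B (a := F.a) hm ha hstrict
    have hmain : c * κ ^ (n - m) * (e.factorial : ℝ) * (σ : ℝ) ^ ((1 + F.a * dd) * (n - m)) <
        1 * (σ : ℝ) ^ (F.a * n * e) := by
      rw [one_mul]
      calc c * κ ^ (n - m) * (e.factorial : ℝ) * (σ : ℝ) ^ ((1 + F.a * dd) * (n - m))
          ≤ (c * κ ^ n * n.factorial) * (σ : ℝ) ^ ((1 + F.a * dd) * (n - m)) :=
            mul_le_mul_of_nonneg_right hKle (by positivity)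
        _ < (σ : ℝ) ^ (F.a * n * e) := const_mul_pow_lt_pow hK0 hexp hσK hσ
    have := reshape one_pos hmain
    rw [mul_one] at this
    exact this.trans_le (mul_le_mul_of_nonneg_right hchoose (pow_nonneg hDpos.le _))

/-- **The zero-estimate numerics hold for the family** (all orders `e`), for `σ` beyond the
explicit threshold `c·(n·2(4n)^{dd})^n·n!`, provided `a > n` and `ℓ > c·(n·2(4n)^{dd})^n·dd!`.
[cite: BakerWustholz2007, §6.8 (p. 119: "ℓS'T^d ≫ D^n")] -/
theorem numerics (hn : 1 ≤ n) (hdd : dd < n) {c : ℝ} (hc : 0 < c) (ha : n < F.a)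
    (hℓc : c * ((n * (2 * (4 * n) ^ dd) : ℕ) : ℝ) ^ n * dd.factorial < F.ℓ) {σ : ℕ} (hσ : 1 ≤ σ)
    (hσK : c * ((n * (2 * (4 * n) ^ dd) : ℕ) : ℝ) ^ n * n.factorial < σ) (e m : ℕ) (hm : m < n)
    (hidx : dd * (n - m) ≤ e * n) :
    (c * ((n * F.D' n dd σ : ℕ) : ℝ) ^ n <
        (Nat.choose (F.T₂ n σ + e) e : ℝ) * ((F.S n σ : ℝ) + 1) * ((n * F.D' n dd σ : ℕ) : ℝ) ^ m) ∧
    (dd * (n - m) < e * n →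
      c * ((n * F.D' n dd σ : ℕ) : ℝ) ^ n < (Nat.choose (F.T₂ n σ + e) e : ℝ) * ((n * F.D' n dd σ : ℕ) : ℝ) ^ m) := by
  by_cases hen : e ≤ n
  · exact F.numerics_le n dd hn hdd hc ha hℓc hσ hσK hen hm hidx
  · -- reduce to `e = n` by monotonicity of `choose`
    have hne : n ≤ e := by omega
    have hidx' : dd * (n - m) ≤ n * n := by nlinarith [Nat.sub_le n m, hdd.le]
    have hstr' : dd * (n - m) < n * n := by
      have : dd * (n - m) ≤ dd * n := Nat.mul_le_mul_left _ (Nat.sub_le _ _)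
      have : dd * n < n * n := Nat.mul_lt_mul_of_lt_of_le hdd le_rfl (by omega)
      omega
    obtain ⟨hA, hB⟩ := F.numerics_le n dd hn hdd hc ha hℓc hσ hσK le_rfl hm hidx'
    have hch : (Nat.choose (F.T₂ n σ + n) n : ℝ) ≤ (Nat.choose (F.T₂ n σ + e) e : ℝ) := by
      exact_mod_cast choose_add_mono _ hne
    have hDm : (0 : ℝ) ≤ ((n * F.D' n dd σ : ℕ) : ℝ) ^ m := by positivity
    have hS0 : (0 : ℝ) ≤ (F.S n σ : ℝ) + 1 := by positivity
    constructor
    · exact hA.trans_le (mul_le_mul_of_nonneg_right (mul_le_mul_of_nonneg_right hch hS0) hDm)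
    · intro _
      exact (hB hstr').trans_le (mul_le_mul_of_nonneg_right hch hDm)

end Family

end BakerData

end Std

end GaGmE

end Literature.NumberTheory.Transcendental

end
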